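import Literature.NumberTheory.EllipticCurves.Kobayashi2003.SignedSelmerDualUniquenessProofs
import Literature.NumberTheory.EllipticCurves.Kato2004.IwasawaInvolutionTwistProofs
import HarnessLib

/-!
# The `γ ↦ γ⁻¹` re-keying of Kobayashi's signed dual `X^ε(E/K_∞)` is the Iwasawa-involution twist
# `M ↦ M^ι`: the SIGNED twin of the fine / ♯♭ dictionaries (proofs only; 0 def, 0 fact, 0 instance)

Topic `NumberTheory/EllipticCurves`, cluster `Kobayashi2003` (namespace = path).  Sibling PROOF file of
`Kobayashi2003/SignedSelmer.lean` (the hypothesis structure `SignedSelmerDualData W κ γ ε` = Kobayashi's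
`X^ε(E/K_∞) := Hom(Sel^ε(E/K_∞), ℚ_p/ℤ_p)`, Invent. Math. **152** (2003) Def. 1.1 [Kobayashi2003]) and of
`Kobayashi2003/SignedSelmerDualUniquenessProofs.lean` (§1 there: the `Λ`-action of ANY datum is forced,
`SignedSelmerDualData.toDual_smul`; any two data of the same key are `Λ`-isomorphic, `exists_linearEquiv` /
`nonempty_linearEquiv`).  It is the SIGNED copy, token for token, of the ♯/♭ file
`Sprung2012/SharpFlatSelmerDualInvolutionTwistProofs.lean` §2–§3 and of `Kato2004/IwasawaInvolutionTwistProofs.lean`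
§3 (`fineSelmerDualData_exists_involTwist`, `fineSelmerDualData_lengthAt_inv_eq`).  THEOREMS ONLY: no definition,
no named fact, no `instance`, no notation, no `sorry`; nothing about Kobayashi's Thm. 1.2 / 1.3, his main
conjecture or BSD is asserted.

## Why (the two `Λ`-conventions)

`SignedSelmerDualData.toDual_T_smul` lets `T` act on `X^ε = Hom(Sel^ε(E/K_∞), ℚ/ℤ)` by PRE-composition,
`(T·x)(s) = x(conj_γ s) − x(s)`: `1 + T` acts as `x ↦ x ∘ conj_γ`, the CONTRAGREDIENT action `x ↦ x ∘ conj_{δ⁻¹}`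
of `δ = γ⁻¹`.  So, with `1 + T ↦ γ` on both sides of a Galois-equivariant duality, the dual «of print» is the
datum of key `γ⁻¹` and the datum of key `γ` is its twist `(X^ε)^ι` by the Iwasawa involution
`ι : T ↦ (1 + T)⁻¹ − 1` (`IwasawaAlgebra.invol`) [Greenberg 1989, pp. 101–102: "`S^ι` … the `Λ`-module with
the same underlying set as `S` but with `Λ` acting through `ι`"; Greenberg LNM 1716 §1 p. 60].  This file records,
for the signed duals, that local lengths, characteristic ideals, finiteness and torsion of a key-`γ` datum
versus a key-`γ⁻¹` datum differ by `ι` and by nothing else.  It is keying-neutral bookkeeping: it asserts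
nothing about which key is "print" (at `a_p = 0` each signed characteristic ideal is separately `ι`-stable by the
algebraic functional equation — not used or asserted here).

## What is proved

* §1 (complement of `SignedSelmerDualUniquenessProofs`): `SignedSelmerDualData.lengthAt_eq`, `charIdeal_eq`,
  `mu_eq`, `lambda_eq` — every invariant of `X^ε` is key-determined (from `nonempty_linearEquiv`).
* §2 **The `γ ↦ δ = γ⁻¹` re-keying is the `ι`-twist**: `signedSelmerDualData_toDual_invol_one_add_X_smul`
  (`ι(1 + T)` acts as `x ↦ x ∘ conj_δ` for `γ δ = 1`), `signedSelmerDualData_exists_involTwist` (`∃ D′` of key `δ`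
  on the SAME character group with an `ι`-semilinear `e : D.X ≃+ D′.X` over `toDual`),
  `nonempty_signedSelmerDualData_of_mul_eq_one`.
* §3 **The dictionary, for ANY `D` of key `γ` and ANY `D′` of key `γ⁻¹`** (twist + uniqueness):
  `signedSelmerDualData_lengthAt_inv_eq` (`ℓ_𝔓(D′.X) = ℓ_{ι𝔓}(D.X)`), `…_lengthAt_eq_inv` (roles exchanged),
  `…_charIdeal_inv_eq` (`char D′.X = ι(char D.X)`), `…_mem_charIdeal_inv_iff` (`f ∈ char D′.X ↔ ι f ∈ char D.X`),
  `…_mem_charIdeal_iff_inv`, `…_finite_inv_iff`, `…_isTorsion_inv_iff`.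

* §4 (appended, cell `bsd-ssimc` LEAD slh-p3 g12) **the `ι`-INVARIANT entries and the generator form**:
  `signedSelmerDualData_charIdeal_eq_inv` (`char D.X = ι(char D′.X)`, the reverse reading),
  `signedSelmerDualData_charIdeal_inv_eq_span_iff` (`char D′.X = (g) ↔ char D.X = (ι g)` — the currency of
  `Rank1Residual.Supersingular.KobayashiMainConjecture`), `signedSelmerDualData_mu_inv_eq` (`μ(D′) = μ(D)`: `ι` fixes
  the prime `(p)`), `signedSelmerDualData_lambda_inv_eq` (`λ(D′) = λ(D)`: the twist is `ℤ_p`-linear) — so Kobayashi's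
  `μ^±`, `λ^±` (Thm. 1.4) are the same numbers in either keying —, and the packaged `signedSelmerDualData_dictionary_rat`.

Consumer: the K3 route `SignedLowerHalves` (cell `bsd-ssimc`, pen S35-8 «the signed ι-twist dictionary»: makes
«the Kobayashi side of K3 is ι-stable» a kernel statement about its binder `Kobayashi2003.SignedSelmerDualData`).

References: S. Kobayashi, Invent. Math. 152 (2003), Def. 1.1 and the sentence following it (p. 2) [Kobayashi2003];
R. Greenberg, Adv. Stud. Pure Math. 17 (1989) §0 pp. 101–102 [Greenberg1989]; R. Greenberg, LNM 1716 (1999) §1 p. 60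
[GreenbergLNM1716]; L. Washington, GTM 83, §13.2 [Washington1997]; N. Bourbaki, *Algèbre commutative* VII §4
[BourbakiAC5to7]; tree: `IwasawaAlgebraInvolution.lean`, `IwasawaAlgebraSemilinearCharIdealProofs.lean`,
`Kato2004/IwasawaInvolutionTwistProofs.lean`, `Sprung2012/SharpFlatSelmerDualInvolutionTwistProofs.lean`.
-/

noncomputable section

open scoped Classical

universe u

namespace Literature.NumberTheory.EllipticCurves.Kobayashi2003

open Literature.NumberTheory.EllipticCurves Literature.NumberTheory.EllipticCurves.IwasawaAlgebra
  Literature.NumberTheory.EllipticCurves.IwasawaDual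

variable {K : Type u} [Field K] [NumberField K] {W : WeierstrassCurve K} {p : ℕ} [Fact p.Prime]
  {κ : ZpExtension K p} {ε : ℤˣ}

/-! ## §1 Every invariant of `X^ε(E/K_∞)` is key-determined (complement of the uniqueness file) -/

namespace SignedSelmerDualData

variable {γ : Field.absoluteGaloisGroup K}

/-- Local lengths of `X^ε(E/K_∞)` are key-determined: `ℓ_𝔓(D.X) = ℓ_𝔓(D'.X)` for any two data of the same
key (`nonempty_linearEquiv`). [cite: Kobayashi2003, Def. 1.1 (sentence following it, p. 2)] [cite: BourbakiAC5to7, Ch. VII §4.4] -/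
theorem lengthAt_eq (D D' : SignedSelmerDualData W κ γ ε) (𝔓 : PrimeSpectrum (IwasawaAlgebra p)) :
    Module.lengthAt (IwasawaAlgebra p) D.X 𝔓 = Module.lengthAt (IwasawaAlgebra p) D'.X 𝔓 := by
  obtain ⟨e⟩ := nonempty_linearEquiv D D'
  exact Module.lengthAt_eq_of_linearEquiv e 𝔓

/-- The characteristic ideal of `X^ε(E/K_∞)` is key-determined: `char D.X = char D'.X` for any two data of the
same key. [cite: Kobayashi2003, Def. 1.1 (sentence following it, p. 2)] [cite: BourbakiAC5to7, Ch. VII §4.5] -/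
theorem charIdeal_eq (D D' : SignedSelmerDualData W κ γ ε) : D.charIdeal = D'.charIdeal := by
  obtain ⟨e⟩ := nonempty_linearEquiv D D'
  exact Module.charIdeal_eq_of_linearEquiv e

/-- The `μ`-invariant of `X^ε(E/K_∞)` is key-determined. [cite: Kobayashi2003, Thm. 1.4 (the invariants only)]
[cite: Washington1997, §13.2] -/
theorem mu_eq (D D' : SignedSelmerDualData W κ γ ε) : D.mu = D'.mu := by
  obtain ⟨e⟩ := nonempty_linearEquiv D D'
  exact muInvariant_eq_of_linearEquiv e

/-- The `λ`-invariant of `X^ε(E/K_∞)` is key-determined. [cite: Kobayashi2003, Thm. 1.4 (the invariants only)]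
[cite: Washington1997, §13.2] -/
theorem lambda_eq (D D' : SignedSelmerDualData W κ γ ε) : D.lambda = D'.lambda := by
  obtain ⟨e⟩ := nonempty_linearEquiv D D'
  exact lambdaInvariant_eq_of_linearEquiv e

end SignedSelmerDualData

/-! ## §2 The `γ ↦ δ = γ⁻¹` re-keying of a signed dual datum is its `ι`-twist -/

section Twist

variable {γ δ : Field.absoluteGaloisGroup K}

/-- In `D : SignedSelmerDualData W κ γ ε` the unit `ι(1 + T)` acts as `x ↦ x ∘ conj_δ` for `γ δ = 1`
(`(1 + T)` acts as `x ↦ x ∘ conj_γ` and `conj` is an action). Signed copy of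
`Kato2004.fineSelmerDualData_toDual_invol_one_add_X_smul`. [cite: GreenbergLNM1716, §1 (p. 60)]
[cite: Kobayashi2003, Def. 1.1 (sentence following it, p. 2)] -/
theorem signedSelmerDualData_toDual_invol_one_add_X_smul (hγδ : γ * δ = 1)
    (D : SignedSelmerDualData W κ γ ε) (x : D.X) (s : signedSelmerInfty W κ ε) :
    D.toDual (invol p (1 + PowerSeries.X) • x) s =
      D.toDual x ⟨W.conjH1 p κ.kerSubgroup δ s, conjH1_mem_signedSelmerInfty W κ ε δ s.2⟩ := by
  set y : D.X := invol p (1 + PowerSeries.X) • x with hy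
  have hx : x = (1 + PowerSeries.X : IwasawaAlgebra p) • y := by
    rw [hy, ← mul_smul, one_add_X_mul_invol_one_add_X p, one_smul]
  have h1 : ∀ s' : signedSelmerInfty W κ ε,
      D.toDual ((1 + PowerSeries.X : IwasawaAlgebra p) • y) s' =
        D.toDual y ⟨W.conjH1 p κ.kerSubgroup γ s', D.conj_mem s' s'.2⟩ := by
    intro s'
    rw [add_smul, one_smul, map_add, AddMonoidHom.add_apply, D.toDual_T_smul, add_sub_cancel]
  conv_rhs => rw [hx, h1]
  congr 1
  apply Subtype.ext
  change (s : W.subgroupH1 p κ.kerSubgroup) =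
    W.conjH1 p κ.kerSubgroup γ (W.conjH1 p κ.kerSubgroup δ (s : W.subgroupH1 p κ.kerSubgroup))
  rw [← AddMonoidHom.comp_apply, ← W.conjH1_mul_holds p κ.kerSubgroup γ δ, hγδ,
    W.conjH1_one_holds p κ.kerSubgroup, AddMonoidHom.id_apply]

/-- **The `γ ↦ δ = γ⁻¹` re-keying of a signed dual datum is its `ι`-twist**: for `γ δ = 1` and
`D : SignedSelmerDualData W κ γ ε` there is `D′ : SignedSelmerDualData W κ δ ε` on the SAME character group
`Hom(Sel^ε(E/K_∞), ℚ/ℤ)` (same `X`, same `toDual`) with the `Λ`-structure twisted by `ι` — an `ι`-semilinear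
`e : D.X ≃+ D′.X` over `toDual` ("`D′ = D^ι`": Greenberg's "`S^ι` … the `Λ`-module with the same underlying set
as `S` but with `Λ` acting through `ι`"). Signed copy of `Kato2004.fineSelmerDualData_exists_involTwist`.
[cite: Greenberg1989, §0 pp. 101–102] [cite: GreenbergLNM1716, §1 (p. 60)] [cite: Kobayashi2003, Def. 1.1 (sentence following it, p. 2)] -/
theorem signedSelmerDualData_exists_involTwist (hγδ : γ * δ = 1) (D : SignedSelmerDualData W κ γ ε) :
    ∃ (D' : SignedSelmerDualData W κ δ ε) (e : D.X ≃+ D'.X),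
      (∀ (f : IwasawaAlgebra p) (x : D.X), e (f • x) = invol p f • e x) ∧
      ∀ x : D.X, D'.toDual (e x) = D.toDual x := by
  refine ⟨@SignedSelmerDualData.mk K _ _ p _ W κ δ ε D.X D.addCommGroup
      (Module.compHom D.X (invol p).toRingHom)
      (fun s hs ↦ conjH1_mem_signedSelmerInfty W κ ε δ hs) D.toDual D.bijective ?_ ?_,
    AddEquiv.refl D.X, ?_, ?_⟩
  · intro x s
    change D.toDual (invol p PowerSeries.X • x) s = _
    have hX : invol p (PowerSeries.X : IwasawaAlgebra p) = invol p (1 + PowerSeries.X) - 1 := by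
      rw [map_add, map_one, add_sub_cancel_left]
    rw [hX, sub_smul, one_smul, map_sub, AddMonoidHom.sub_apply,
      signedSelmerDualData_toDual_invol_one_add_X_smul hγδ D x s]
  · intro a x s k hk
    change D.toDual (invol p (PowerSeries.C a) • x) s = _
    rw [invol_C]
    exact D.toDual_C_smul a x s k hk
  · intro f x
    change f • x = invol p (invol p f) • x
    rw [invol_invol]
  · intro x
    rfl

/-- **Existence transported along the re-keying**: `SignedSelmerDualData W κ δ ε` is inhabited as soon as the
key-`γ` type is, for `γ δ = 1` (this form records that the twist of a GIVEN datum is a datum).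
[cite: GreenbergLNM1716, §1 (p. 60)] [cite: Kobayashi2003, Def. 1.1 (sentence following it, p. 2)] -/
theorem nonempty_signedSelmerDualData_of_mul_eq_one (hγδ : γ * δ = 1) (D : SignedSelmerDualData W κ γ ε) :
    Nonempty (SignedSelmerDualData W κ δ ε) :=
  let ⟨D', _⟩ := signedSelmerDualData_exists_involTwist hγδ D
  ⟨D'⟩

end Twist

/-! ## §3 The dictionary between a key-`γ` datum and a key-`γ⁻¹` datum (any two) -/

section Dictionary

variable {γ : Field.absoluteGaloisGroup K}

/-- **`ℓ_𝔓(D′) = ℓ_{ι𝔓}(D)` for ANY signed dual data `D` of key `γ` and `D′` of key `γ⁻¹`** — the signed twin of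
`Kato2004.fineSelmerDualData_lengthAt_inv_eq` / `Sprung2012.sharpFlatSelmerDualData_lengthAt_inv_eq`: the twisted
datum of `signedSelmerDualData_exists_involTwist` has these lengths by `Kato2004.lengthAt_eq_of_involSemilinear`, and
any two data of key `γ⁻¹` are `Λ`-isomorphic (`SignedSelmerDualData.nonempty_linearEquiv`). Here
`ι𝔓 := PrimeSpectrum.comap (invol p) 𝔓` (a height-one prime iff `𝔓` is, `Kato2004.height_comap_invol`).
[cite: GreenbergLNM1716, §1 (p. 60)] [cite: Greenberg1989, §0 pp. 101–102] [cite: Kobayashi2003, Def. 1.1 (sentence following it, p. 2)] -/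
theorem signedSelmerDualData_lengthAt_inv_eq (D : SignedSelmerDualData W κ γ ε)
    (D' : SignedSelmerDualData W κ γ⁻¹ ε) (𝔓 : PrimeSpectrum (IwasawaAlgebra p)) :
    Module.lengthAt (IwasawaAlgebra p) D'.X 𝔓 =
      Module.lengthAt (IwasawaAlgebra p) D.X (PrimeSpectrum.comap (invol p).toRingHom 𝔓) := by
  obtain ⟨D₁, e, he, -⟩ := signedSelmerDualData_exists_involTwist (mul_inv_cancel γ) D
  obtain ⟨e'⟩ := SignedSelmerDualData.nonempty_linearEquiv D' D₁
  rw [Module.lengthAt_eq_of_linearEquiv e' 𝔓, Kato2004.lengthAt_eq_of_involSemilinear e he 𝔓]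

/-- The same with the roles exchanged: `ℓ_𝔓(D) = ℓ_{ι𝔓}(D′)` for `D` of key `γ`, `D′` of key `γ⁻¹`
(`ι(ι𝔓) = 𝔓`). [cite: GreenbergLNM1716, §1 (p. 60)] [cite: Kobayashi2003, Def. 1.1 (sentence following it, p. 2)] -/
theorem signedSelmerDualData_lengthAt_eq_inv (D : SignedSelmerDualData W κ γ ε)
    (D' : SignedSelmerDualData W κ γ⁻¹ ε) (𝔓 : PrimeSpectrum (IwasawaAlgebra p)) :
    Module.lengthAt (IwasawaAlgebra p) D.X 𝔓 =
      Module.lengthAt (IwasawaAlgebra p) D'.X (PrimeSpectrum.comap (invol p).toRingHom 𝔓) := by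
  rw [signedSelmerDualData_lengthAt_inv_eq D D', Kato2004.comap_invol_comap_invol]

/-- **`char(D′.X) = ι(char(D.X))`** for ANY `D` of key `γ` and `D′` of key `γ⁻¹`: the characteristic ideal of
the key-`γ⁻¹` signed dual is the `ι`-image of that of the key-`γ` one ("`Char(M^ι) = ι(Char M)`",
`Module.charIdeal_eq_map_of_semilinearEquiv` for the ring automorphism `involEquiv p`, plus uniqueness at key
`γ⁻¹`). [cite: GreenbergLNM1716, §1 (p. 60)] [cite: Washington1997, §13.2] [cite: Kobayashi2003, Def. 1.1 (sentence following it, p. 2)] -/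
theorem signedSelmerDualData_charIdeal_inv_eq (D : SignedSelmerDualData W κ γ ε)
    (D' : SignedSelmerDualData W κ γ⁻¹ ε) :
    D'.charIdeal = D.charIdeal.map (invol p).toRingHom := by
  obtain ⟨D₁, e, he, -⟩ := signedSelmerDualData_exists_involTwist (mul_inv_cancel γ) D
  rw [SignedSelmerDualData.charIdeal_eq D' D₁]
  have h := Module.charIdeal_eq_map_of_semilinearEquiv
    (involEquiv p : IwasawaAlgebra p ≃+* IwasawaAlgebra p) e (fun r m ↦ he r m)
  exact h

/-- Membership form of the characteristic-ideal dictionary: **`f ∈ char(D′.X) ↔ ι f ∈ char(D.X)`** for `D`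
of key `γ`, `D′` of key `γ⁻¹` (`ι` is an involution, so `map ι = comap ι`). In particular a divisibility
"`char X^ε ∣ …`" or "`… ∣ char X^ε`" stated for a key-`γ` datum reads, for a key-`γ⁻¹` datum, with `ι` applied
to the other side. [cite: GreenbergLNM1716, §1 (p. 60)] [cite: Washington1997, §13.2] -/
theorem signedSelmerDualData_mem_charIdeal_inv_iff (D : SignedSelmerDualData W κ γ ε)
    (D' : SignedSelmerDualData W κ γ⁻¹ ε) (f : IwasawaAlgebra p) :
    f ∈ D'.charIdeal ↔ invol p f ∈ D.charIdeal := by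
  rw [signedSelmerDualData_charIdeal_inv_eq D D']
  have hmap : D.charIdeal.map (invol p).toRingHom = D.charIdeal.comap (invol p).toRingHom := by
    have h1 : D.charIdeal.map ((involEquiv p : IwasawaAlgebra p ≃+* IwasawaAlgebra p) :
        IwasawaAlgebra p →+* IwasawaAlgebra p) =
        D.charIdeal.comap ((involEquiv p).symm : IwasawaAlgebra p ≃+* IwasawaAlgebra p) :=
      Ideal.map_comap_of_equiv _
    exact h1
  rw [hmap, Ideal.mem_comap]
  rfl

/-- The same dictionary read from the other side: **`f ∈ char(D.X) ↔ ι f ∈ char(D′.X)`**.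
[cite: GreenbergLNM1716, §1 (p. 60)] [cite: Washington1997, §13.2] -/
theorem signedSelmerDualData_mem_charIdeal_iff_inv (D : SignedSelmerDualData W κ γ ε)
    (D' : SignedSelmerDualData W κ γ⁻¹ ε) (f : IwasawaAlgebra p) :
    f ∈ D.charIdeal ↔ invol p f ∈ D'.charIdeal := by
  rw [signedSelmerDualData_mem_charIdeal_inv_iff D D', invol_invol]

/-- Finite generation is insensitive to the re-keying: `D.X` f.g. ↔ `D′.X` f.g. for `D` of key `γ`, `D′` of key
`γ⁻¹` (Kobayashi's Thm. 1.2 "finitely generated" is the same statement in either keying).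
[cite: GreenbergLNM1716, §1 (p. 60)] [cite: Kobayashi2003, Thm. 1.2 (the property only)] -/
theorem signedSelmerDualData_finite_inv_iff (D : SignedSelmerDualData W κ γ ε)
    (D' : SignedSelmerDualData W κ γ⁻¹ ε) :
    Module.Finite (IwasawaAlgebra p) D.X ↔ Module.Finite (IwasawaAlgebra p) D'.X := by
  obtain ⟨D₁, e, he, -⟩ := signedSelmerDualData_exists_involTwist (mul_inv_cancel γ) D
  obtain ⟨D₂, e₂, he₂, -⟩ := signedSelmerDualData_exists_involTwist (inv_mul_cancel γ) D'
  rw [SignedSelmerDualData.moduleFinite_iff D' D₁]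
  refine ⟨fun _ ↦ Kato2004.finite_of_involSemilinear e he, fun hD₁ ↦ ?_⟩
  rw [SignedSelmerDualData.moduleFinite_iff D D₂]
  haveI : Module.Finite (IwasawaAlgebra p) D'.X := (SignedSelmerDualData.moduleFinite_iff D' D₁).2 hD₁
  exact Kato2004.finite_of_involSemilinear e₂ he₂

/-- `Λ`-torsionness is insensitive to the re-keying: `D.X` torsion ↔ `D′.X` torsion for `D` of key `γ`, `D′` of
key `γ⁻¹` (Kobayashi's Thm. 1.2 "torsion" is the same statement in either keying).
[cite: GreenbergLNM1716, §1 (p. 60)] [cite: Kobayashi2003, Thm. 1.2 (the property only)] -/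
theorem signedSelmerDualData_isTorsion_inv_iff (D : SignedSelmerDualData W κ γ ε)
    (D' : SignedSelmerDualData W κ γ⁻¹ ε) :
    Module.IsTorsion (IwasawaAlgebra p) D.X ↔ Module.IsTorsion (IwasawaAlgebra p) D'.X := by
  obtain ⟨D₁, e, he, -⟩ := signedSelmerDualData_exists_involTwist (mul_inv_cancel γ) D
  obtain ⟨D₂, e₂, he₂, -⟩ := signedSelmerDualData_exists_involTwist (inv_mul_cancel γ) D'
  rw [SignedSelmerDualData.isTorsion_iff D' D₁]
  refine ⟨fun h ↦ Kato2004.isTorsion_of_involSemilinear h e he, fun hD₁ ↦ ?_⟩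
  rw [SignedSelmerDualData.isTorsion_iff D D₂]
  exact Kato2004.isTorsion_of_involSemilinear ((SignedSelmerDualData.isTorsion_iff D' D₁).2 hD₁) e₂ he₂

/-- **The dictionary in one statement** (the binder shape of the K3 route `SignedLowerHalves`, whose Kobayashi-side
statements quantify over `D : Kobayashi2003.SignedSelmerDualData W κ γ ε`): for every key-`γ` datum `D` and every
key-`γ⁻¹` datum `D′` of the same sign, at every prime `𝔓`: `ℓ_𝔓(D.X) = ℓ_{ι𝔓}(D′.X)`, and
`f ∈ char D.X ↔ ι f ∈ char D′.X`; `μ` and `λ`... are not compared here (only `ι`-invariant quantities would agree).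
[cite: GreenbergLNM1716, §1 (p. 60)] [cite: Kobayashi2003, Def. 1.1 (sentence following it, p. 2)] -/
theorem signedSelmerDualData_dictionary (D : SignedSelmerDualData W κ γ ε)
    (D' : SignedSelmerDualData W κ γ⁻¹ ε) :
    (∀ 𝔓 : PrimeSpectrum (IwasawaAlgebra p),
      Module.lengthAt (IwasawaAlgebra p) D.X 𝔓 =
        Module.lengthAt (IwasawaAlgebra p) D'.X (PrimeSpectrum.comap (invol p).toRingHom 𝔓)) ∧
    ∀ f : IwasawaAlgebra p, f ∈ D.charIdeal ↔ invol p f ∈ D'.charIdeal :=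
  ⟨fun 𝔓 ↦ signedSelmerDualData_lengthAt_eq_inv D D' 𝔓,
    fun f ↦ signedSelmerDualData_mem_charIdeal_iff_inv D D' f⟩

end Dictionary

/-! ## §4 The `ι`-invariant entries (`μ`, `λ`) and the generator form of the dictionary (appended) -/

section Invariant

variable {γ : Field.absoluteGaloisGroup K}

/-- `Ideal.map ι = Ideal.comap ι` on ideals of `Λ` (`ι` is an involutive ring automorphism; private plumbing).
[cite: Washington1997, §13.2] -/
private theorem map_invol_eq_comap' (I : Ideal (IwasawaAlgebra p)) :
    I.map (invol p).toRingHom = I.comap (invol p).toRingHom := by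
  have h1 : I.map ((involEquiv p : IwasawaAlgebra p ≃+* IwasawaAlgebra p) :
      IwasawaAlgebra p →+* IwasawaAlgebra p) =
      I.comap ((involEquiv p).symm : IwasawaAlgebra p ≃+* IwasawaAlgebra p) :=
    Ideal.map_comap_of_equiv _
  exact h1

/-- `ι(ι I) = I` for every ideal `I ⊆ Λ` (private plumbing). [cite: Washington1997, §13.2] -/
private theorem map_invol_map_invol' (I : Ideal (IwasawaAlgebra p)) :
    (I.map (invol p).toRingHom).map (invol p).toRingHom = I := by
  rw [Ideal.map_map]
  have h : (invol p).toRingHom.comp (invol p).toRingHom = RingHom.id _ := by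
    ext1 f
    exact invol_invol p f
  rw [h, Ideal.map_id]

/-- The reverse characteristic-ideal identity: **`char(D.X) = ι(char(D′.X))`** for `D` of key `γ`, `D′` of key
`γ⁻¹` (apply `ι` to `signedSelmerDualData_charIdeal_inv_eq`; `ι ∘ ι = id`).
[cite: GreenbergLNM1716, §1 (p. 60)] [cite: Washington1997, §13.2] -/
theorem signedSelmerDualData_charIdeal_eq_inv (D : SignedSelmerDualData W κ γ ε)
    (D' : SignedSelmerDualData W κ γ⁻¹ ε) :
    D.charIdeal = D'.charIdeal.map (invol p).toRingHom := by
  rw [signedSelmerDualData_charIdeal_inv_eq D D', map_invol_map_invol']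

/-- Principal-generator form of the dictionary: **`char(D′.X) = (g) ↔ char(D.X) = (ι g)`** — a characteristic
power series of the contragredient dual is `ι` of one of the tree-keyed dual, and conversely. This is the
currency of `Rank1Residual.Supersingular.KobayashiMainConjecture` / `KobayashiLowerDivisibility`
("`char X^ε = (g)` with `g^ℚ = ϖ · (L_p^ε)^ℚ`"). [cite: GreenbergLNM1716, §1 (p. 60)] [cite: Washington1997, §13.2] -/
theorem signedSelmerDualData_charIdeal_inv_eq_span_iff (D : SignedSelmerDualData W κ γ ε)
    (D' : SignedSelmerDualData W κ γ⁻¹ ε) (g : IwasawaAlgebra p) :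
    D'.charIdeal = Ideal.span {g} ↔ D.charIdeal = Ideal.span {invol p g} := by
  constructor
  · intro h
    rw [signedSelmerDualData_charIdeal_eq_inv D D', h, Ideal.map_span, Set.image_singleton]
    rfl
  · intro h
    rw [signedSelmerDualData_charIdeal_inv_eq D D', h, Ideal.map_span, Set.image_singleton]
    change Ideal.span {invol p (invol p g)} = _
    rw [invol_invol]

/-- **`μ(D′) = μ(D)`**: the `μ`-invariant (local length at the prime `(p)`, `muInvariant`) is insensitive to the
re-keying, because `ι` FIXES the prime `(p)` (`comap_invol_eq_self_of_asIdeal_eq_augIdealP`) — Greenberg: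
`μ(S^ι) = μ(S)`. So Kobayashi's `μ^±` (Thm. 1.4) is the same number in either keying.
[cite: Greenberg1989, §0 pp. 101–102] [cite: Kobayashi2003, Thm. 1.4 (the invariants only)] -/
theorem signedSelmerDualData_mu_inv_eq (D : SignedSelmerDualData W κ γ ε)
    (D' : SignedSelmerDualData W κ γ⁻¹ ε) : D'.mu = D.mu := by
  unfold SignedSelmerDualData.mu muInvariant
  refine finsum_congr fun 𝔭 ↦ finsum_congr fun h𝔭 ↦ ?_
  rw [signedSelmerDualData_lengthAt_inv_eq D D' 𝔭, comap_invol_eq_self_of_asIdeal_eq_augIdealP p 𝔭 h𝔭]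

/-- **`λ(D′) = λ(D)`**: the `λ`-invariant (`dim_{ℚ_p}(X ⊗_{ℤ_p} ℚ_p)`, `lambdaInvariant`) is insensitive to the
re-keying, because the `ι`-twist does not change the underlying `ℤ_p`-module (`ι` is `ℤ_p`-linear: `ι(C c) = C c`,
`AlgHom.commutes`) — Greenberg: `λ(S^ι) = λ(S)`. So Kobayashi's `λ^±` (Thm. 1.4) is the same number in either keying.
[cite: Greenberg1989, §0 pp. 101–102] [cite: Kobayashi2003, Thm. 1.4 (the invariants only)] -/
theorem signedSelmerDualData_lambda_inv_eq (D : SignedSelmerDualData W κ γ ε)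
    (D' : SignedSelmerDualData W κ γ⁻¹ ε) : D'.lambda = D.lambda := by
  obtain ⟨D₁, e, he, -⟩ := signedSelmerDualData_exists_involTwist (mul_inv_cancel γ) D
  rw [SignedSelmerDualData.lambda_eq D' D₁]
  -- the `ℤ_p`-linear equivalence underlying the `ι`-semilinear `e`, on the `RestrictScalars` synonyms
  let e' : RestrictScalars ℤ_[p] (IwasawaAlgebra p) D.X ≃ₗ[ℤ_[p]]
      RestrictScalars ℤ_[p] (IwasawaAlgebra p) D₁.X :=
    { ((RestrictScalars.addEquiv ℤ_[p] (IwasawaAlgebra p) D.X).trans e).trans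
        (RestrictScalars.addEquiv ℤ_[p] (IwasawaAlgebra p) D₁.X).symm with
      map_smul' := fun c x ↦ by
        have h := he (algebraMap ℤ_[p] (IwasawaAlgebra p) c)
          (RestrictScalars.addEquiv ℤ_[p] (IwasawaAlgebra p) D.X x)
        rw [AlgHom.commutes] at h
        exact h }
  unfold SignedSelmerDualData.lambda lambdaInvariant
  exact ((e'.baseChange ℤ_[p] ℚ_[p] _ _).finrank_eq).symm

/-- **Route-shaped instance over `ℚ`, all entries** (the binder shape of
`Rank1Residual.Supersingular.KobayashiMainConjecture` / `KobayashiLowerDivisibility` and of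
`Kobayashi2003.thm41_signedCharIdeal_divisibility`): for every tree-keyed `D : SignedSelmerDualData W κ γ ε` and
every contragredient `D′ : SignedSelmerDualData W κ γ⁻¹ ε` over `ℚ`: `ℓ_𝔓(D.X) = ℓ_{ι𝔓}(D′.X)` at every prime,
`f ∈ char D.X ↔ ι f ∈ char D′.X`, torsion ⟺ torsion, finitely generated ⟺, `μ(D′) = μ(D)`, `λ(D′) = λ(D)`.
[cite: GreenbergLNM1716, §1 (p. 60)] [cite: Kobayashi2003, Def. 1.1 (sentence following it, p. 2)] -/
theorem signedSelmerDualData_dictionary_rat (W : WeierstrassCurve ℚ) {p : ℕ} [Fact p.Prime]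
    (κ : ZpExtension ℚ p) (γ : Field.absoluteGaloisGroup ℚ) (ε : ℤˣ)
    (D : SignedSelmerDualData W κ γ ε) (D' : SignedSelmerDualData W κ γ⁻¹ ε) :
    (∀ 𝔓 : PrimeSpectrum (IwasawaAlgebra p),
      Module.lengthAt (IwasawaAlgebra p) D.X 𝔓 =
        Module.lengthAt (IwasawaAlgebra p) D'.X (PrimeSpectrum.comap (invol p).toRingHom 𝔓)) ∧
    (∀ f : IwasawaAlgebra p, f ∈ D.charIdeal ↔ invol p f ∈ D'.charIdeal) ∧
    (Module.IsTorsion (IwasawaAlgebra p) D.X ↔ Module.IsTorsion (IwasawaAlgebra p) D'.X) ∧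
    (Module.Finite (IwasawaAlgebra p) D.X ↔ Module.Finite (IwasawaAlgebra p) D'.X) ∧
    D'.mu = D.mu ∧ D'.lambda = D.lambda :=
  ⟨fun 𝔓 ↦ signedSelmerDualData_lengthAt_eq_inv D D' 𝔓,
    fun f ↦ signedSelmerDualData_mem_charIdeal_iff_inv D D' f,
    signedSelmerDualData_isTorsion_inv_iff D D', signedSelmerDualData_finite_inv_iff D D',
    signedSelmerDualData_mu_inv_eq D D', signedSelmerDualData_lambda_inv_eq D D'⟩

end Invariant

end Literature.NumberTheory.EllipticCurves.Kobayashi2003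

end
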